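import Summits.Ventures.CertifiedManyBodySolver.Certificates.HubbardSquare_sandwich_La214_v110
import Summits.Ventures.CertifiedManyBodySolver.Downfold.BoxesLa214V110Controls
import Summits.Ventures.CertifiedManyBodySolver.Downfold.BoxesYBCO7Words
import Summits.Ventures.CertifiedManyBodySolver.Downfold.ThermalAnnexSeam
import HarnessLib

/-!
# HYPOTHESIS-FREE T-AXIS WORDS, BATCH B: the La-214 x = 0.30 CONTROL column (`boxLa214E_M50v110`, object E — a NOT-superconducting validation material) and the
# YBCO #18 OBJECT-M box (`boxYBCO7M_M18`, `t–t′` truncation) — closed `T = 0` words through `ThermalAnnexSeam.holdsOn_thermalAnnex_of_cellWord`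

Venture CertifiedManyBodySolver, cell `pub/hubbard-downfold` (stage S1 ↔ S2 seam, D-0099 T axis), seat hubbard-downfold-mod-1; namespace
`Summit.Ventures.CertifiedManyBodySolver.Downfold`. Sequel of `BoxesThermalAnnexClosed{La214,CCOCHg,Nickelates,M}.lean`. For every temperature cell `Θ` (`0 < kT₁`), member,
`β' ≥ p t_eV/kT`, torus-limit canonical-SECTOR Gibbs state: `e(ω) ∈ [F, C + 1.3863·kT₂/t₁]`:
* `boxLa214E_M50v110_thermalAnnex_closed` — `sw_la214Ev110_M50_word` [-1.4695512241, -0.7442643298], `t₁ = 0.30`: `300 K` cap **-0.6241183298**, `100 K` **-0.7040616298**;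
* `boxYBCO7M_M18_ttPrimeThermalAnnex_closed` — `yBCO7M_M18_sandwich_window` [−1.5601315986, −0.4945932713], `t₁ = 0.34`: `300 K` cap **-0.3885820948**, `100 K` **-0.4591203007**
  (the YBCO #18 object-E annex `boxYBCO7E_M18_thermalAnnex` is conditional on 5 node sheets; this object-M word is hypothesis-free but about the single-layer `t–t′` truncation).
HONEST FRAMING: energy windows (density-keyed sector-Gibbs torus limits) in units of the member's `t`; no hypothesis of any kind; the YBCO object-M row ignores `t″` and the
bilayer `t⊥` (EXTRAPOLATED frame, as the source word says); nothing here is a phase sentence, an order word or a `T_c`. Everything is PROVED; no definition, no `sorry`.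
-/

noncomputable section

namespace Summit.Ventures.CertifiedManyBodySolver.Downfold

open NonemptyInterval Literature.MathematicalPhysics.QuantumLattice
  Literature.MathematicalPhysics.QuantumLattice.ThermodynamicLimit
  Literature.MathematicalPhysics.QuantumLattice.InfVolFermionState
  Literature.Probability.LatticeModels _root_.Filter
  Summit.Ventures.CertifiedManyBodySolver.Certificates

open scoped ComplexOrder

/-- **HYPOTHESIS-FREE typed T-axis word on `boxLa214E_M50v110`** (La₁.₇Sr₀.₃CuO₄ x = 0.30, the NOT-superconducting La-214 CONTROL column M50; object E, `t₁ = 3/10` eV):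
for every temperature cell `Θ` (`0 < kT₁`), `kT ∈ Θ`, member `p`, `β' ≥ p t_eV/kT`, every torus-limit sector-Gibbs state of `H(1, p tp/t, p U/t)` at `β'`:
**`e(ω) ∈ [-1.4695512241, -0.7442643298 + 1.3863/((3/10)/kT₂)]`** (`T ≤ 300 K`: cap -0.6241183298; `100 K`: -0.7040616298) — the CLOSED word `sw_la214Ev110_M50_word` through
`holdsOn_thermalAnnex_of_cellWord`. No hypothesis. [cite: Israel1979, Thm. I.3.4] [cite: Ruelle1969, §2.5–2.6] -/
theorem boxLa214E_M50v110_thermalAnnex_closed {Θ : NonemptyInterval ℚ} (hΘ : 0 < Θ.fst) {kT : ℝ} (hk : kT ∈ Θ.ratCast ℝ) :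
    HoldsOn (fun p : OneBandCoord → ℝ => ∀ β' : ℝ, p .tEV / kT ≤ β' →
      ∀ (ω : InfVolFermionState 2) (Ls : ℕ → ℕ), Tendsto Ls atTop atTop →
        ω.IsTorusLimitOfMixture (sectorGibbsCount (p .filling))
          (fun L => sectorGibbsWeightTT' β' 1 (p .tpOverT) (p .UOverT) (p .filling) L)
          (fun L => sectorGibbsVectorTT' 1 (p .tpOverT) (p .UOverT) (p .filling) L) Ls →
        ω.meanEnergy (hubbardTTPrimeFermionInteraction 1 (p .tpOverT) (p .UOverT)) 1 ∈
          Set.Icc (-1.4695512241 : ℝ) ((-0.7442643298 : ℝ) + 1.3863 / ((((3/10 : ℚ) / Θ.snd : ℚ)) : ℝ))) boxLa214E_M50v110 :=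
  holdsOn_thermalAnnex_of_cellWord (B := boxLa214E_M50v110) (eU := la214E_M50v110_U) (eS := la214E_M50v19_tp) (eN := la214E_M50v19_n) (eT := la214E_M50v19_t)
    boxLa214E_M50v110_U boxLa214E_M50v110_tp boxLa214E_M50v110_n (by rw [boxLa214E_M50v110, Box.withEntry_of_ne _ _ (by decide)]; rfl)
    (by rw [la214E_M50v110_U, Entry.encl_ofEnds_fst]; norm_num) (by rw [la214E_M50v19_n, Entry.encl_ofEnds_fst]; norm_num)
    (by rw [la214E_M50v19_n, Entry.encl_ofEnds_snd]; norm_num) (by rw [la214E_M50v19_t, Entry.encl_ofEnds_fst]) (by norm_num)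
    (by rw [la214E_M50v110_s2Lo, la214E_M50v110_s2Hi]; exact sw_la214Ev110_M50_word) hΘ hk

/-- **HYPOTHESIS-FREE typed T-axis word on `boxYBCO7M_M18`** (YBa₂Cu₃O₆.₉₂ #18 OBJECT M — bilayer material, single-layer `t–t′` TRUNCATION of the member
(`tpp/t ∈ [0.16, 0.27]`, `tperp/t ∈ [0.30, 0.45]` NOT in the Hamiltonian); `t₁ = 17/50` eV): for every temperature cell `Θ` (`0 < kT₁`), `kT ∈ Θ`, member `p`,
`β' ≥ p t_eV/kT`, every torus-limit sector-Gibbs state of `H(1, p tp/t, p U/t)` at `β'`: **`e(ω) ∈ [−1.5601315986, −0.4945932713 + 1.3863/((17/50)/kT₂)]`**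
(`T ≤ 300 K`: cap -0.3885820948; `100 K`: -0.4591203007) — the closed cell word `yBCO7M_M18_sandwich_window` (box-p2's `aw_ybco7M_M18_word` restricted to the M cell, `BoxesYBCO7Words.lean`)
through `holdsOn_thermalAnnex_of_cellWord`. No hypothesis. [cite: Israel1979, Thm. I.3.4] [cite: Ruelle1969, §2.5–2.6] -/
theorem boxYBCO7M_M18_ttPrimeThermalAnnex_closed {Θ : NonemptyInterval ℚ} (hΘ : 0 < Θ.fst) {kT : ℝ} (hk : kT ∈ Θ.ratCast ℝ) :
    HoldsOn (fun p : OneBandCoord → ℝ => ∀ β' : ℝ, p .tEV / kT ≤ β' →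
      ∀ (ω : InfVolFermionState 2) (Ls : ℕ → ℕ), Tendsto Ls atTop atTop →
        ω.IsTorusLimitOfMixture (sectorGibbsCount (p .filling))
          (fun L => sectorGibbsWeightTT' β' 1 (p .tpOverT) (p .UOverT) (p .filling) L)
          (fun L => sectorGibbsVectorTT' 1 (p .tpOverT) (p .UOverT) (p .filling) L) Ls →
        ω.meanEnergy (hubbardTTPrimeFermionInteraction 1 (p .tpOverT) (p .UOverT)) 1 ∈
          Set.Icc (-1.5601315986 : ℝ) ((-0.4945932713 : ℝ) + 1.3863 / ((((17/50 : ℚ) / Θ.snd : ℚ)) : ℝ))) boxYBCO7M_M18 :=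
  holdsOn_thermalAnnex_of_cellWord (B := boxYBCO7M_M18) (eU := yBCO7M_M18_U) (eS := yBCO7M_M18_tp) (eN := yBCO7M_M18_n) (eT := yBCO7M_M18_t) rfl rfl rfl rfl
    (by rw [yBCO7M_M18_U, Entry.encl_ofEnds_fst]; norm_num) (by rw [yBCO7M_M18_n, Entry.encl_ofEnds_fst]; norm_num)
    (by rw [yBCO7M_M18_n, Entry.encl_ofEnds_snd]; norm_num) (by rw [yBCO7M_M18_t, Entry.encl_ofEnds_fst]) (by norm_num)
    (by rw [yBCO7M_M18_s2Lo, yBCO7M_M18_s2Hi]; exact yBCO7M_M18_sandwich_window) hΘ hk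

end Summit.Ventures.CertifiedManyBodySolver.Downfold

end
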